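import Literature.IUT.LogVolume.TameDualPair
import Literature.IUT.LogVolume.TameQuadraticDualPair
import HarnessLib

/-!
# Isometries of a Galois `p`-adic field of degree PRIME TO `p` are units of the integral Galois order `𝒪_K⟨Gal⟩`;
# all quadratic fields at odd `p` — unramified `ℚ_p(√ε)`, `ℚ_p(√p)` AND the twisted `ℚ_p(√(εp))` — in one stroke

Classical local algebra (Serre, *Local Fields* III §3; Neukirch II (4.8), (5.5)); nothing disputed; proof-only (theorems, no
definition, no `Prop` fact, no `sorry`).  abc-iut cell, block E, seat abc-iut-E-t52 (gen 6): the ONE authors-first companion on this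
seat's own lineage — it discharges the `-- TODO(general form)` left in the header of `TameQuadraticIsometryGaloisOrder.lean` (p462786,
gen 5: «the twisted case `π² = ε·p`») WITHOUT any uniformiser, through abc-iut-E-t42's one-axis criterion
`TameDualPair.exists_galoisOrder_repr_of_isometry_of_not_wild` (p464861: `K/ℚ_p` Galois ∧ `¬ hwild` ⟹ every `ℚ_p`-linear isometry
`g` has `g, g⁻¹ ∈ 𝒪_K⟨Gal(K/ℚ_p)⟩` with integral Dedekind coefficients), where `hwild := ∀ x, ‖x‖ ≤ 1 → ‖Tr_{K/ℚ_p} x‖ < 1` is the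
hypothesis of the cell's negative half (p457646).

* §1 **`not_wild_of_not_dvd_finrank`** — if `p ∤ [K : ℚ_p]` then `hwild` FAILS: the scalar `x := 1/[K : ℚ_p] ∈ K` has `‖x‖ = 1`
  (`‖n‖_p = 1` for `p ∤ n`) and `Tr x = [K : ℚ_p] · x = 1` (Mathlib `Algebra.trace_algebraMap`).  (A degree prime to `p` is the
  cheapest sufficient condition for tameness; the converse direction is not claimed — an unramified `K` of degree `p` is tame too.)
* §2 **`exists_galoisOrder_repr_of_isometry_of_not_dvd_finrank`** — hence for `K/ℚ_p` finite GALOIS with `p ∤ [K : ℚ_p]`, EVERY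
  `ℚ_p`-linear isometry `g` of `K` has `g` and `g⁻¹` of the shape `y ↦ Σ_{τ ∈ T} c_τ·τ(y)`, `τ ∈ Aut_{ℚ_p-alg}(K)`, `‖c_τ‖ ≤ 1` — verbatim
  the per-place binder `hIsmG` of the cell's `Summit.ABC.IUTFork.Joshi.PinsGaloisOrder.exists_pinnedRegions_honestSetting_of_galoisOrderIsm`
  (p460152) and the field hypothesis «Galois ∧ ¬hwild» of `Summit.ABC.IUTFork.Joshi.PinsIsometricLine` (p465219);
  `exists_galoisOrder_repr_of_norm_le_of_not_dvd_finrank` — the same for every norm-NON-INCREASING `ℚ_p`-linear map (membership in the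
  order, not only its unit group); `…_of_finrank_lt` — the small-degree form `[K : ℚ_p] < p`.
* §3 **`exists_galoisOrder_repr_of_isometry_of_finrank_two`** — `p` ODD and `[K : ℚ_p] = 2`, NO OTHER HYPOTHESIS (a quadratic
  extension is Galois: abc-iut-E-t42's `TameQuadratic.isGalois`, p462996): so the conclusion of p462786 / p462996 (stated there for
  `π² = p` only) and the `e = 2` rung of abc-iut-E-t58's `TameRadicalDualPair` (p464614, `π^e = p`, `e ∣ p − 1`) hold at ALL THREE
  quadratic fields of `ℚ_p` — the unramified `ℚ_p(√ε)`, `ℚ_p(√p)`, and the TWISTED ramified `ℚ_p(√(εp))` (`ε` a non-square unit) that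
  the tame cluster's joint read recorded as «OUTSIDE the cluster … OPEN» (abc-iut-E-t25, STATUS 2026-08-26T19:42:47Z, INFO I1 / R4).
* §4 NON-VACUITY of the twisted class inside `ℚ̄_p`: for EVERY `c ∈ ℚ_p` with `‖c‖ = p⁻¹` (i.e. `c = ε·p`, `ε` any unit) there is
  `E ⊆ ℚ̄_p` with `[E : ℚ_p] = 2` and `π ∈ E`, `π² = c` (`exists_subfield_sq_eq`: `X² − c` has no root in `ℚ_p` because absolute values
  of `ℚ_p^×` are INTEGRAL powers of `p`), `‖π‖² = p⁻¹` (so `E` is ramified), and at every such `E`, `p` odd, every isometry is a unit of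
  `𝒪_E⟨Gal⟩` (`exists_twistedQuadratic_isometry_galoisOrder`).

Use (abc-iut cell, R-J row Y-29b, located not adjudicated): a per-place SUPPLIER of `hIsmG` / of p465219's «Galois ∧ ¬hwild»; no
`Summit.*` import (Literature side; the Joshi-side corollaries belong to the `PinsIsometricLine` lineage).  CONTAINERS only; no side
is taken on [IUTchIII] Cor. 3.12 or on any author; typed ≠ proved ≠ endorsed.
Locators: Serre III §3 Prop. 7 = `Tr(𝔟) ⊆ 𝔞 ⟺ 𝔟 ⊆ 𝔞·𝔇⁻¹` (trace duality / the different; `¬hwild ⟺ Tr(𝒪_K) = ℤ_p`); Serre III §6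
Prop. 13 = `v_𝔓(𝔇) ≥ e − 1` with equality iff `e` is prime to `p` (a degree prime to `p` forces `p ∤ e`: tame); Neukirch II §2 =
`|a|_p = p^{-v_p(a)}`; Neukirch II (4.8) = the unique extension of `|·|_p` to a finite `K` (`|α| = |N(α)|^{1/n}`); [IUTchIV] Prop. 1.1 =
the locus of use.
[cite: SerreLocalFields1979, Ch. III §3, Prop. 7] [cite: SerreLocalFields1979, Ch. III §6, Prop. 13] [cite: NeukirchANT1999, Ch. II §2 p. 107]
[cite: NeukirchANT1999, Ch. II (4.8)] [cite: Mochizuki2012, IUTchIV Prop. 1.1 p. 9]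
-/

noncomputable section

open Module

namespace Literature.IUT.LogVolume

namespace TameDegree

variable {p : ℕ} [Fact p.Prime]
variable {K : Type} [NontriviallyNormedField K] [NormedAlgebra ℚ_[p] K]

/-! ## §1 A degree prime to `p` makes the trace form non-wild -/

/-- `‖1/n‖_p = 1` for `p ∤ n` (`|a|_p = p^{-v_p(a)}`). [cite: NeukirchANT1999, Ch. II §2 p. 107] -/
theorem norm_inv_natCast_eq_one {n : ℕ} (hn : ¬ p ∣ n) : ‖(n : ℚ_[p])⁻¹‖ = 1 := by
  rw [norm_inv, Padic.norm_natCast_eq_one_iff.mpr ((Nat.Prime.coprime_iff_not_dvd Fact.out).mpr hn), inv_one]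

/-- The witness `x := 1/[K : ℚ_p] ∈ K` is a UNIT: `‖x‖ = 1` when `p ∤ [K : ℚ_p]`. [cite: NeukirchANT1999, Ch. II (4.8)] -/
theorem norm_algebraMap_inv_finrank (hn : ¬ p ∣ finrank ℚ_[p] K) :
    ‖algebraMap ℚ_[p] K ((finrank ℚ_[p] K : ℚ_[p])⁻¹)‖ = 1 := by
  rw [norm_algebraMap', norm_inv_natCast_eq_one hn]

/-- … and has TRACE ONE: `Tr_{K/ℚ_p}(1/[K : ℚ_p]) = [K : ℚ_p] · (1/[K : ℚ_p]) = 1` (`K` finite over `ℚ_p`).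
[cite: SerreLocalFields1979, Ch. III §3, Prop. 7] -/
theorem trace_algebraMap_inv_finrank [FiniteDimensional ℚ_[p] K] :
    Algebra.trace ℚ_[p] K (algebraMap ℚ_[p] K ((finrank ℚ_[p] K : ℚ_[p])⁻¹)) = 1 := by
  rw [Algebra.trace_algebraMap, nsmul_eq_mul]
  exact mul_inv_cancel₀ (Nat.cast_ne_zero.mpr finrank_pos.ne')

/-- **`p ∤ [K : ℚ_p]` ⟹ the trace form is NOT wild**: `¬ ∀ x, ‖x‖ ≤ 1 → ‖Tr_{K/ℚ_p} x‖ < 1` — the literal NEGATION of the hypothesis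
`hwild` of the cell's `Summit.ABC.IUTFork.Joshi.PinsIsometricShear.not_pinnedRegions_honestSetting_of_isometries_of_wild` (p457646) and
the hypothesis of abc-iut-E-t42's `TameDualPair.exists_galoisOrder_repr_of_isometry_of_not_wild` (p464861); witness `x = 1/[K : ℚ_p]`
(`‖x‖ = 1`, `Tr x = 1`).  (`¬hwild` says `Tr(𝒪_K) ∋` a unit, i.e. `Tr(𝒪_K) = ℤ_p`; a degree prime to `p` forces `p ∤ e`, the tame case.)
[cite: SerreLocalFields1979, Ch. III §3, Prop. 7] [cite: SerreLocalFields1979, Ch. III §6, Prop. 13] [cite: NeukirchANT1999, Ch. II (4.8)] -/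
theorem not_wild_of_not_dvd_finrank [FiniteDimensional ℚ_[p] K] (hn : ¬ p ∣ finrank ℚ_[p] K) :
    ¬ ∀ x : K, ‖x‖ ≤ 1 → ‖Algebra.trace ℚ_[p] K x‖ < 1 := by
  intro h
  have h1 := h _ (norm_algebraMap_inv_finrank hn).le
  rw [trace_algebraMap_inv_finrank, norm_one] at h1
  exact lt_irrefl _ h1

/-- The small-degree form: `0 < [K : ℚ_p] < p` ⟹ `p ∤ [K : ℚ_p]` ⟹ not wild. [cite: SerreLocalFields1979, Ch. III §3, Prop. 7] -/
theorem not_wild_of_finrank_lt [FiniteDimensional ℚ_[p] K] (hlt : finrank ℚ_[p] K < p) :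
    ¬ ∀ x : K, ‖x‖ ≤ 1 → ‖Algebra.trace ℚ_[p] K x‖ < 1 :=
  not_wild_of_not_dvd_finrank (Nat.not_dvd_of_pos_of_lt finrank_pos hlt)

/-! ## §2 Galois of degree prime to `p`: every isometry is a unit of `𝒪_K⟨Gal(K/ℚ_p)⟩` -/

/-- **ISOMETRIES OF A GALOIS `K/ℚ_p` OF DEGREE PRIME TO `p` ARE UNITS OF THE INTEGRAL GALOIS ORDER.**  For `K/ℚ_p` finite Galois with
`p ∤ [K : ℚ_p]` and a `ℚ_p`-linear ISOMETRY `g` of `K`: both `g` and `g⁻¹` are `y ↦ Σ_{τ ∈ T} c_τ·τ(y)` with `τ ∈ Aut_{ℚ_p-alg}(K)`,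
`‖c_τ‖ ≤ 1` — verbatim the per-place binder `hIsmG` of the cell's `Summit.ABC.IUTFork.Joshi.PinsGaloisOrder` (p460152).  Proof: §1 +
abc-iut-E-t42's `TameDualPair.exists_galoisOrder_repr_of_isometry_of_not_wild` (orthogonal basis → norm-unimodular trace dual →
integral Dedekind coefficients); `ProperSpace K` is derived (`ℚ_p` locally compact, `K` finite-dimensional), not assumed.
Instances: every quadratic `K` at odd `p` (§3); cyclic cubic `K` at `p ≠ 3`; the biquadratic `ℚ_p(√ε, √p)` at odd `p`; … .
[cite: SerreLocalFields1979, Ch. III §3, Prop. 7] [cite: NeukirchANT1999, Ch. II (4.8)] -/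
theorem exists_galoisOrder_repr_of_isometry_of_not_dvd_finrank [IsUltrametricDist K] [FiniteDimensional ℚ_[p] K]
    [IsGalois ℚ_[p] K] (hn : ¬ p ∣ finrank ℚ_[p] K) (g : K ≃ₗ[ℚ_[p]] K) (hg : ∀ x, ‖g x‖ = ‖x‖) :
    (∃ (T : Finset (K ≃ₐ[ℚ_[p]] K)) (c : (K ≃ₐ[ℚ_[p]] K) → K), (∀ τ ∈ T, ‖c τ‖ ≤ 1) ∧ ∀ x, g x = ∑ τ ∈ T, c τ * τ x) ∧
    (∃ (T : Finset (K ≃ₐ[ℚ_[p]] K)) (c : (K ≃ₐ[ℚ_[p]] K) → K), (∀ τ ∈ T, ‖c τ‖ ≤ 1) ∧ ∀ x, g.symm x = ∑ τ ∈ T, c τ * τ x) := by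
  haveI : ProperSpace K := FiniteDimensional.proper ℚ_[p] K
  exact TameDualPair.exists_galoisOrder_repr_of_isometry_of_not_wild (not_wild_of_not_dvd_finrank hn) g hg

/-- **The order itself, not only its units**: for `K/ℚ_p` finite Galois with `p ∤ [K : ℚ_p]`, every norm-NON-INCREASING `ℚ_p`-linear
`f : K → K` (`‖f x‖ ≤ ‖x‖`) is `y ↦ Σ_{τ ∈ T} c_τ·τ(y)` with `‖c_τ‖ ≤ 1`, i.e. lies in `𝒪_K⟨Gal(K/ℚ_p)⟩` (§1 + abc-iut-E-t42's
`TameDualPair.exists_normUnimodular_dualPair_of_not_wild` + `exists_galoisOrder_repr_of_norm_le`, p464861 / p462048).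
[cite: SerreLocalFields1979, Ch. III §3, Prop. 7] [cite: NeukirchANT1999, Ch. II (4.8)] -/
theorem exists_galoisOrder_repr_of_norm_le_of_not_dvd_finrank [IsUltrametricDist K] [FiniteDimensional ℚ_[p] K]
    [IsGalois ℚ_[p] K] (hn : ¬ p ∣ finrank ℚ_[p] K) (f : K →ₗ[ℚ_[p]] K) (hf : ∀ x, ‖f x‖ ≤ ‖x‖) :
    ∃ (T : Finset (K ≃ₐ[ℚ_[p]] K)) (c : (K ≃ₐ[ℚ_[p]] K) → K), (∀ τ ∈ T, ‖c τ‖ ≤ 1) ∧ ∀ x, f x = ∑ τ ∈ T, c τ * τ x := by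
  classical
  haveI : ProperSpace K := FiniteDimensional.proper ℚ_[p] K
  obtain ⟨_, b, d, hbd, hnorm⟩ := TameDualPair.exists_normUnimodular_dualPair_of_not_wild (not_wild_of_not_dvd_finrank hn)
  exact exists_galoisOrder_repr_of_norm_le b d hbd hnorm f hf

/-- The small-degree form of §2: `K/ℚ_p` finite Galois with `[K : ℚ_p] < p` ⟹ every `ℚ_p`-linear isometry is a unit of `𝒪_K⟨Gal⟩`
(`g` and `g⁻¹` in the `hIsmG` shape of p460152). [cite: SerreLocalFields1979, Ch. III §3, Prop. 7] [cite: NeukirchANT1999, Ch. II (4.8)] -/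
theorem exists_galoisOrder_repr_of_isometry_of_finrank_lt [IsUltrametricDist K] [FiniteDimensional ℚ_[p] K]
    [IsGalois ℚ_[p] K] (hlt : finrank ℚ_[p] K < p) (g : K ≃ₗ[ℚ_[p]] K) (hg : ∀ x, ‖g x‖ = ‖x‖) :
    (∃ (T : Finset (K ≃ₐ[ℚ_[p]] K)) (c : (K ≃ₐ[ℚ_[p]] K) → K), (∀ τ ∈ T, ‖c τ‖ ≤ 1) ∧ ∀ x, g x = ∑ τ ∈ T, c τ * τ x) ∧
    (∃ (T : Finset (K ≃ₐ[ℚ_[p]] K)) (c : (K ≃ₐ[ℚ_[p]] K) → K), (∀ τ ∈ T, ‖c τ‖ ≤ 1) ∧ ∀ x, g.symm x = ∑ τ ∈ T, c τ * τ x) :=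
  exists_galoisOrder_repr_of_isometry_of_not_dvd_finrank (Nat.not_dvd_of_pos_of_lt finrank_pos hlt) g hg

/-! ## §3 All quadratic fields at odd `p` (no uniformiser hypothesis): the twisted case of p462786's TODO included -/

/-- `p` odd does not divide `2` (so a quadratic degree is prime to `p`: the tame case). [cite: SerreLocalFields1979, Ch. III §6, Prop. 13] -/
theorem not_dvd_two (hp : p ≠ 2) : ¬ p ∣ 2 := fun h =>
  hp ((Nat.prime_dvd_prime_iff_eq Fact.out Nat.prime_two).mp h)

/-- **EVERY ISOMETRY OF A QUADRATIC `K/ℚ_p`, `p` ODD, IS A UNIT OF `𝒪_K⟨Gal(K/ℚ_p)⟩`** — with NO hypothesis beyond `p ≠ 2` and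
`[K : ℚ_p] = 2` (Galois by abc-iut-E-t42's `TameQuadratic.isGalois`; `2` is prime to `p`): `g` and `g⁻¹` have the `hIsmG` shape of the
cell's `Summit.ABC.IUTFork.Joshi.PinsGaloisOrder` (p460152).  This is the conclusion of `TameQuadratic.exists_galoisOrder_of_isometry(_symm)`
(p462786) / `TameQuadratic.exists_galoisOrder_repr_of_isometry` (p462996), proved there under `π² = p`, now at ALL THREE quadratic
fields of `ℚ_p`: unramified `ℚ_p(√ε)`, `ℚ_p(√p)`, and the TWISTED ramified `ℚ_p(√(εp))` — p462786's `TODO(general form)` discharged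
without a uniformiser. [cite: SerreLocalFields1979, Ch. III §3, Prop. 7] [cite: NeukirchANT1999, Ch. II (4.8)] -/
theorem exists_galoisOrder_repr_of_isometry_of_finrank_two [IsUltrametricDist K] (hp : p ≠ 2)
    (hK : finrank ℚ_[p] K = 2) (g : K ≃ₗ[ℚ_[p]] K) (hg : ∀ x, ‖g x‖ = ‖x‖) :
    (∃ (T : Finset (K ≃ₐ[ℚ_[p]] K)) (c : (K ≃ₐ[ℚ_[p]] K) → K), (∀ τ ∈ T, ‖c τ‖ ≤ 1) ∧ ∀ x, g x = ∑ τ ∈ T, c τ * τ x) ∧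
    (∃ (T : Finset (K ≃ₐ[ℚ_[p]] K)) (c : (K ≃ₐ[ℚ_[p]] K) → K), (∀ τ ∈ T, ‖c τ‖ ≤ 1) ∧ ∀ x, g.symm x = ∑ τ ∈ T, c τ * τ x) := by
  haveI : FiniteDimensional ℚ_[p] K := Module.finite_of_finrank_eq_succ hK
  haveI : IsGalois ℚ_[p] K := TameQuadratic.isGalois hK
  exact exists_galoisOrder_repr_of_isometry_of_not_dvd_finrank (hK ▸ not_dvd_two hp) g hg

/-- The order form at a quadratic `K`, `p` odd: every norm-non-increasing `ℚ_p`-linear `f` lies in `𝒪_K⟨Gal⟩`.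
[cite: SerreLocalFields1979, Ch. III §3, Prop. 7] [cite: NeukirchANT1999, Ch. II (4.8)] -/
theorem exists_galoisOrder_repr_of_norm_le_of_finrank_two [IsUltrametricDist K] (hp : p ≠ 2)
    (hK : finrank ℚ_[p] K = 2) (f : K →ₗ[ℚ_[p]] K) (hf : ∀ x, ‖f x‖ ≤ ‖x‖) :
    ∃ (T : Finset (K ≃ₐ[ℚ_[p]] K)) (c : (K ≃ₐ[ℚ_[p]] K) → K), (∀ τ ∈ T, ‖c τ‖ ≤ 1) ∧ ∀ x, f x = ∑ τ ∈ T, c τ * τ x := by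
  haveI : FiniteDimensional ℚ_[p] K := Module.finite_of_finrank_eq_succ hK
  haveI : IsGalois ℚ_[p] K := TameQuadratic.isGalois hK
  exact exists_galoisOrder_repr_of_norm_le_of_not_dvd_finrank (hK ▸ not_dvd_two hp) f hf

/-! ## §4 Non-vacuity of the twisted class: `ℚ_p(√c) ⊆ ℚ̄_p` for every `c` with `‖c‖ = p⁻¹` -/

/-- An element of `ℚ_p` of absolute value `p⁻¹` is NOT a square in `ℚ_p`: absolute values of `ℚ_p^×` are `p^ℤ`, and `‖a‖² = p⁻¹` would
need the exponent `1/2` (valuations: `2·v(a) = v(c) = 1`). [cite: NeukirchANT1999, Ch. II §2 p. 107] -/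
theorem sq_ne_of_norm_eq_inv (c : ℚ_[p]) (hc : ‖c‖ = (p : ℝ)⁻¹) (a : ℚ_[p]) : a ^ 2 ≠ c := by
  intro ha
  have hp0 : (0 : ℝ) < p := by exact_mod_cast (Fact.out : p.Prime).pos
  have hp1 : (p : ℝ) ≠ 1 := by exact_mod_cast (Fact.out : p.Prime).ne_one
  have hc0 : c ≠ 0 := fun h => by
    rw [h, norm_zero] at hc
    exact (inv_pos.mpr hp0).ne hc
  have hval : c.valuation = 1 := by
    have h1 := Padic.norm_eq_zpow_neg_valuation hc0
    rw [hc, ← zpow_neg_one, zpow_right_inj₀ hp0 hp1] at h1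
    omega
  have h2 : (a ^ 2).valuation = 2 * a.valuation := Padic.valuation_pow a 2
  rw [ha, hval] at h2
  omega

open Polynomial IntermediateField in
/-- **A twisted (or not) ramified quadratic subfield of `ℚ̄_p` for every admissible square class**: for every `c ∈ ℚ_p` with
`‖c‖ = p⁻¹` — i.e. `c = ε·p` for an arbitrary unit `ε`, square or not — there are `E ⊆ ℚ̄_p` with `[E : ℚ_p] = 2` and `π ∈ E`,
`π² = c` (`E = ℚ_p(√c)`; the minimal polynomial of `√c` is `X² − c` since `c` is not a square, `sq_ne_of_norm_eq_inv`); its absolute value is the unique extension `|π| = |N(π)|^{1/2} = |c|^{1/2}`.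
[cite: NeukirchANT1999, Ch. II (4.8)] -/
theorem exists_subfield_sq_eq (p : ℕ) [Fact p.Prime] (c : ℚ_[p]) (hc : ‖c‖ = (p : ℝ)⁻¹) :
    ∃ (E : IntermediateField ℚ_[p] (PadicAlgCl p)) (π : E), FiniteDimensional ℚ_[p] E ∧
      finrank ℚ_[p] E = 2 ∧ π ^ 2 = algebraMap ℚ_[p] E c := by
  obtain ⟨α, hα⟩ := IsAlgClosed.exists_pow_nat_eq (algebraMap ℚ_[p] (PadicAlgCl p) c) (by norm_num : 0 < 2)
  have heval : Polynomial.aeval α (X ^ 2 - C c) = 0 := by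
    rw [map_sub, aeval_X_pow, aeval_C, hα, sub_self]
  have hint : IsIntegral ℚ_[p] α := ⟨X ^ 2 - C c, monic_X_pow_sub_C _ (by norm_num), by
    simpa [Polynomial.aeval_def] using heval⟩
  haveI hfd : FiniteDimensional ℚ_[p] ℚ_[p]⟮α⟯ := adjoin.finiteDimensional hint
  have hnot : α ∉ (algebraMap ℚ_[p] (PadicAlgCl p)).range := by
    rintro ⟨a, rfl⟩
    refine sq_ne_of_norm_eq_inv c hc a ((algebraMap ℚ_[p] (PadicAlgCl p)).injective ?_)
    rw [map_pow, hα]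
  have hdeg : (minpoly ℚ_[p] α).natDegree = 2 := by
    refine le_antisymm ?_ ((minpoly.two_le_natDegree_iff hint).mpr hnot)
    have hdvd : minpoly ℚ_[p] α ∣ X ^ 2 - C c := minpoly.dvd ℚ_[p] α heval
    have hne : (X ^ 2 - C c) ≠ 0 := (monic_X_pow_sub_C _ (by norm_num)).ne_zero
    calc (minpoly ℚ_[p] α).natDegree ≤ (X ^ 2 - C c).natDegree := natDegree_le_of_dvd hdvd hne
      _ = 2 := natDegree_X_pow_sub_C
  have hπE : (⟨α, mem_adjoin_simple_self ℚ_[p] α⟩ : ℚ_[p]⟮α⟯) ^ 2 = algebraMap ℚ_[p] ℚ_[p]⟮α⟯ c := by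
    apply Subtype.ext
    have hcE : ((algebraMap ℚ_[p] ℚ_[p]⟮α⟯ c : ℚ_[p]⟮α⟯) : PadicAlgCl p) = algebraMap ℚ_[p] (PadicAlgCl p) c :=
      (IsScalarTower.algebraMap_apply ℚ_[p] ℚ_[p]⟮α⟯ (PadicAlgCl p) c).symm
    rw [hcE, ← hα]
    rfl
  exact ⟨ℚ_[p]⟮α⟯, ⟨α, mem_adjoin_simple_self ℚ_[p] α⟩, hfd, by rw [adjoin.finrank hint, hdeg], hπE⟩

/-- **The twisted class is NON-VACUOUS and covered**: for `p` odd and every `c ∈ ℚ_p` with `‖c‖ = p⁻¹` there is a quadratic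
`E = ℚ_p(√c) ⊆ ℚ̄_p`, RAMIFIED (`‖π‖² = p⁻¹` for `π = √c ∈ E`, an absolute value outside `p^ℤ`), at which EVERY `ℚ_p`-linear isometry
`g` has `g, g⁻¹ ∈ 𝒪_E⟨Gal(E/ℚ_p)⟩` with integral coefficients (§3).  With `c = p` this is p462786's `exists_tameQuadratic_isometry_galoisOrder`;
with `c = ε·p`, `ε` a non-square unit, it is the twisted field `ℚ_p(√(εp))` of that file's TODO.
[cite: SerreLocalFields1979, Ch. III §3, Prop. 7] [cite: NeukirchANT1999, Ch. II (4.8)] -/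
theorem exists_twistedQuadratic_isometry_galoisOrder (p : ℕ) [Fact p.Prime] (hp : p ≠ 2) (c : ℚ_[p])
    (hc : ‖c‖ = (p : ℝ)⁻¹) :
    ∃ (E : IntermediateField ℚ_[p] (PadicAlgCl p)) (_ : FiniteDimensional ℚ_[p] E) (π : E),
      finrank ℚ_[p] E = 2 ∧ π ^ 2 = algebraMap ℚ_[p] E c ∧ ‖π‖ ^ 2 = (p : ℝ)⁻¹ ∧
        ∀ (g : (E : Type) ≃ₗ[ℚ_[p]] E), (∀ x, ‖g x‖ = ‖x‖) →
          (∃ (T : Finset ((E : Type) ≃ₐ[ℚ_[p]] E)) (c : ((E : Type) ≃ₐ[ℚ_[p]] E) → E),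
              (∀ τ ∈ T, ‖c τ‖ ≤ 1) ∧ ∀ y, g y = ∑ τ ∈ T, c τ * τ y) ∧
          (∃ (T : Finset ((E : Type) ≃ₐ[ℚ_[p]] E)) (c : ((E : Type) ≃ₐ[ℚ_[p]] E) → E),
              (∀ τ ∈ T, ‖c τ‖ ≤ 1) ∧ ∀ y, g.symm y = ∑ τ ∈ T, c τ * τ y) := by
  obtain ⟨E, π, hfd, hK, hπ⟩ := exists_subfield_sq_eq p c hc
  have hnorm : ‖π‖ ^ 2 = (p : ℝ)⁻¹ := by
    rw [← norm_pow, hπ]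
    exact (norm_algebraMap' (E : Type) c).trans hc
  exact ⟨E, hfd, π, hK, hπ, hnorm, fun g hg =>
    exists_galoisOrder_repr_of_isometry_of_finrank_two (K := E) hp hK g hg⟩

end TameDegree

end Literature.IUT.LogVolume

end
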